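import Summits.Ventures.HSemireg.SecantParityWeilTypeProduct
import Summits.Ventures.HSemireg.SecantParityWeilTypeEndomorphism
import Summits.Ventures.HSemireg.SecantParityObjectLevelEffectiveCycles
import Summits.Ventures.HSemireg.SecantParityObjectLevelEFour
import Literature.Geometry.Kaehler.ComplexTorusWeilTypeHermitianForm
import HarnessLib

/-!
# Venture HSemireg — Markman's triple as the tree's `IsPolarizedWeilType`: `(X × X̂, A, N·Ξ_d)` is a POLARISED complex torus of Weil
# type (Lange §7.2.4 ∕ van Geemen Def. 4.9, tree `ComplexTorus.IsPolarizedWeilType`) **iff `η` is a Riemann form** (and `N·(-Ξ_d)` iff `-η`);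
# every CYCLE-TYPE secant object sits on such a polarised triple; and the sheet's `E⁴` counter-model direction gives `index Ξ_d = 2` (polarised
# for NEITHER orientation) — TRACK S4-PUSH (ii), seat `s4-prove-1` (g12 draft, g13 filing); file XIId, record `s4push/prove-1/ATTEMPT-15.md` §6

HONEST FRAMING. Lean index of the computation cell `pub-hsemireg`; object level as in files XII (the form `Ξ_d = d·η ⊞ η^*`, `index Ξ_d = 2·index η`,
`±` positivity) and XIIb∕c (the rational endomorphism `A = (0 (ᵗG)⁻¹; -d·ᵗG 0)` with `ρₐ(A) = F_d`, `IsWeilType`). Composition only: the tree's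
`IsPolarizedWeilType Φ η α d n` (a Weil-type torus + a polarisation `E` with `ρ(√-d)^*E = dE`, Lange Exercise 7.2.4 (6) = [vG94 Def. 4.9]
«E is a polarization on X with `(√-d)^*E = dE`») holds for `(X × X̂, N·Ξ_d, A)` iff `η` is a Riemann form of `X`, for `(X × X̂, N·(-Ξ_d), A)` iff `-η`
is; and by file VIII's Lelong dichotomy every cycle-type secant direction (`[Z]_e = c·θ^{∧p}`, `c > 0`) gives one of the two. So Markman's standing
assumption [Mar25 Assumption 2.4.1 + Prop. 2.4.4's setting] is AUTOMATIC for cycle-type objects and FAILS for every intermediate-index direction;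
CONSISTENCY INSTANCE (sheet S3INP-4 ∕ S3INP-15, ref-4's erratum «(4, 12)»): for file IVb's `η₄ = e₁ + e₂ + e₃ − e₄` on `E_τ⁴` (index `1`,
`∫ η₄⁴ = −24`) the form `Ξ_d = d·η₄ ⊞ η₄^*` has `hermIndex = 2` for every `d > 0` (`hermIndex_Xi_eFour`), so `±Ξ_d` is positive for neither sign.
KERNEL-CHECKED before filing in a scratch file inlining the tree texts of XII and XIIb∕c (farm rc 0 · 0 · 0) while their oleans were unbuilt;
nothing here says that HC, HC_CM or HC_AV holds; (S3)'s signed words do not move. NO definition, NO named fact; theorems only, 0 sorry.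

## References
* [vanGeemen1994HodgeAV] = [vG94] B. van Geemen, LNM 1594 (1994), §4 Def. 4.9, Lemma 5.2. Held: `book:green1994-algebraic-cycles-hodge-theory-lectures-given-at` p0218, p0220.
* [Markman2025SecantWeil] = [Mar25] E. Markman, arXiv:2502.03415, §2.4 Assumption 2.4.1, Prop. 2.4.4, Cor. 3.2.3.
* [Lange2023AbelianVarietiesComplex] H. Lange, Abelian Varieties over the Complex Numbers (2023), §7.2.4 and Exercise (6); §1.1.2 Prop. 1.1.6; §1.6.2.
* [GohbergLancasterRodman2005] I. Gohberg, P. Lancaster, L. Rodman, Indefinite Linear Algebra and Applications (2005), §2.2 (as used by file IVb).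
* [Chirka1989] E. M. Chirka, Complex Analytic Sets (1989), §14.2 Prop. 2 (as used by file VIII).
-/

noncomputable section

open scoped ComplexOrder Manifold
open Complex Module
open Literature.Analysis.Complex Literature.Analysis.Complex.WeilOperator
open Literature.Geometry.Kaehler Literature.Geometry.Kaehler.ComplexTorus

namespace Summit.Ventures.HSemireg

namespace SecantParity

section Polarized

variable {ι : Type*} [Fintype ι] [DecidableEq ι] {E : Type*} [NormedAddCommGroup E] [NormedSpace ℂ E]
  (Φ : (ι → ℝ) ≃L[ℝ] E) {η : E [⋀^Fin 2]→L[ℝ] ℝ} (hnd : ∀ u : E, (∀ v, η ![u, v] = 0) → u = 0) {G : Matrix ι ι ℤ}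

/-- `ρₐ(A)` as a REAL-linear map is `F_d` pointwise. [cite: Lange2023AbelianVarietiesComplex, §1.1.2 Prop. 1.1.6] -/
theorem analyticRepReal_weilMatrix_apply (hη : IsNSForm Φ η) (hG : G.map (Int.cast : ℤ → ℝ) = latticeGram Φ η) (d : ℕ)
    (u : E × (E →L⋆[ℂ] ℂ)) :
    analyticRepReal (prodPeriod Φ (dualPeriod Φ)) (prodPeriod Φ (dualPeriod Φ))
        ((Matrix.fromBlocks 0 (G.transpose.map (Int.cast : ℤ → ℚ))⁻¹ ((-(d : ℚ)) • G.transpose.map (Int.cast : ℤ → ℚ)) 0).map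
          (Rat.cast : ℚ → ℝ)) u =
      ((phiHEquiv Φ hη.type_one_one hnd).symm u.2, -(((d : ℝ) : ℂ) • phiHEquiv Φ hη.type_one_one hnd u.1)) := by
  obtain ⟨x, rfl⟩ := (prodPeriod Φ (dualPeriod Φ)).surjective u
  rw [analyticRepReal_apply]
  exact prodPeriod_weilMatrix_mulVec Φ hnd hη hG d x

/-- **MARKMAN'S TRIPLE IS A POLARISED ABELIAN VARIETY OF WEIL TYPE (tree `IsPolarizedWeilType`) IFF `η` IS A RIEMANN FORM** —
positive orientation `N·Ξ_d`. [cite: vanGeemen1994HodgeAV, §4 Def. 4.9] [cite: Markman2025SecantWeil, §2.4 Prop. 2.4.4 and Cor. 3.2.3] -/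
theorem isPolarizedWeilType_smul_Xi_iff (hη : IsNSForm Φ η) (hG : G.map (Int.cast : ℤ → ℝ) = latticeGram Φ η)
    {g : ℕ} {δ : Fin (g + 1) → ℕ} (hδ : IsPolarizationType Φ η δ) {d : ℕ} (hd : 0 < d) (hfin : finrank ℂ E = g + 1) :
    IsPolarizedWeilType (prodPeriod Φ (dualPeriod Φ))
        (((δ 0 * δ (Fin.last g) : ℕ) : ℝ) • prodForm ((d : ℝ) • η) (dualForm Φ hη.type_one_one hnd))
        (Matrix.fromBlocks 0 (G.transpose.map (Int.cast : ℤ → ℚ))⁻¹ ((-(d : ℚ)) • G.transpose.map (Int.cast : ℤ → ℚ)) 0)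
        d (g + 1) ↔
      IsRiemannForm Φ η := by
  constructor
  · intro h
    exact (isRiemannForm_smul_Xi_iff Φ hη.type_one_one hnd hη hδ hd).1 h.isRiemannForm
  · intro h
    refine ⟨isWeilType_weilMatrix Φ hnd hη hG hd hfin (Nat.succ_pos g),
      (isRiemannForm_smul_Xi_iff Φ hη.type_one_one hnd hη hδ hd).2 h, fun u v ↦ ?_⟩
    rw [analyticRepReal_weilMatrix_apply Φ hnd hη hG d, analyticRepReal_weilMatrix_apply Φ hnd hη hG d,
      ContinuousAlternatingMap.smul_apply, ContinuousAlternatingMap.smul_apply, Xi_weilOperator, smul_eq_mul, smul_eq_mul]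
    push_cast
    ring

/-- **… negative orientation: `N·(-Ξ_d)`-polarised Weil type iff `-η` is a Riemann form.**
[cite: vanGeemen1994HodgeAV, §4 Def. 4.9] [cite: Markman2025SecantWeil, §2.4 Prop. 2.4.4 and Cor. 3.2.3] -/
theorem isPolarizedWeilType_smul_neg_Xi_iff (hη : IsNSForm Φ η) (hG : G.map (Int.cast : ℤ → ℝ) = latticeGram Φ η)
    {g : ℕ} {δ : Fin (g + 1) → ℕ} (hδ : IsPolarizationType Φ η δ) {d : ℕ} (hd : 0 < d) (hfin : finrank ℂ E = g + 1) :
    IsPolarizedWeilType (prodPeriod Φ (dualPeriod Φ))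
        (((δ 0 * δ (Fin.last g) : ℕ) : ℝ) • (-prodForm ((d : ℝ) • η) (dualForm Φ hη.type_one_one hnd)))
        (Matrix.fromBlocks 0 (G.transpose.map (Int.cast : ℤ → ℚ))⁻¹ ((-(d : ℚ)) • G.transpose.map (Int.cast : ℤ → ℚ)) 0)
        d (g + 1) ↔
      IsRiemannForm Φ (-η) := by
  constructor
  · intro h
    exact (isRiemannForm_smul_neg_Xi_iff Φ hη.type_one_one hnd hη hδ hd).1 h.isRiemannForm
  · intro h
    refine ⟨isWeilType_weilMatrix Φ hnd hη hG hd hfin (Nat.succ_pos g),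
      (isRiemannForm_smul_neg_Xi_iff Φ hη.type_one_one hnd hη hδ hd).2 h, fun u v ↦ ?_⟩
    rw [analyticRepReal_weilMatrix_apply Φ hnd hη hG d, analyticRepReal_weilMatrix_apply Φ hnd hη hG d,
      ContinuousAlternatingMap.smul_apply, ContinuousAlternatingMap.smul_apply, ContinuousAlternatingMap.neg_apply,
      ContinuousAlternatingMap.neg_apply, Xi_weilOperator, smul_eq_mul, smul_eq_mul]
    push_cast
    ring

end Polarized

section EFourConsistency

variable {τ : ℂ} (hτ : 0 < τ.im)

/-- `η₄ = (E_τ ⊞ E_τ) ⊞ (E_τ ⊞ (−E_τ))` is non-degenerate in the «trivial left kernel» form consumed by `phiHEquiv` ∕ `dualForm`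
(file IVb's `nondegenerate_eFour`, contraposed). [cite: GohbergLancasterRodman2005, §2.2] -/
theorem eq_zero_of_forall_eFour_apply_eq_zero (u : (ℂ × ℂ) × (ℂ × ℂ))
    (hu : ∀ v, prodForm (prodForm (ellipticForm hτ.ne') (ellipticForm hτ.ne'))
        (prodForm (ellipticForm hτ.ne') (-ellipticForm hτ.ne')) ![u, v] = 0) : u = 0 := by
  by_contra h
  obtain ⟨w, hw⟩ := nondegenerate_eFour hτ u h
  exact hw (hu w)

/-- **CONSISTENCY INSTANCE (sheet S3INP-4 ∕ S3INP-15).** For the `E⁴` counter-model direction `η₄ = e₁ + e₂ + e₃ − e₄` on `X = E_τ⁴`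
(`hermIndex η₄ = 1`, `∫_X η₄^{∧4} = −24`, file IVb) Markman's form `Ξ_d = d·η₄ ⊞ η₄^*` on `T₀(X × X̂) ≅ ℂ⁸` has **`hermIndex Ξ_d = 2`** for
every `d > 0`: `2 ∉ {0, 8}`, so NEITHER `Ξ_d` NOR `-Ξ_d` is positive — the `K`-secant planes with this direction polarise `X × X̂` for neither
orientation («`g_P` of signature `(4, 12)` on `V_ℝ ≅ ℝ¹⁶»). [cite: Markman2025SecantWeil, §2.4 Prop. 2.4.4]
[cite: Lange2023AbelianVarietiesComplex, §1.6.2] -/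
theorem hermIndex_Xi_eFour {d : ℝ} (hd : 0 < d) :
    hermIndex (prodForm (d • prodForm (prodForm (ellipticForm hτ.ne') (ellipticForm hτ.ne'))
          (prodForm (ellipticForm hτ.ne') (-ellipticForm hτ.ne')))
        (dualForm (prodPeriod (prodPeriod (ellipticPeriod hτ.ne') (ellipticPeriod hτ.ne'))
            (prodPeriod (ellipticPeriod hτ.ne') (ellipticPeriod hτ.ne')))
          (isNSForm_eFour hτ).type_one_one (eq_zero_of_forall_eFour_apply_eq_zero hτ))) = 2 := by
  rw [hermIndex_Xi _ (isNSForm_eFour hτ).type_one_one (eq_zero_of_forall_eFour_apply_eq_zero hτ) hd, hermIndex_eFour hτ]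

end EFourConsistency

section CycleType

universe u

variable {κ : Type*} [Fintype κ] [DecidableEq κ] {V : Type u} [NormedAddCommGroup V] [InnerProductSpace ℂ V]
  [FiniteDimensional ℂ V] [MeasurableSpace V] [BorelSpace V] (Ψ : (κ → ℝ) ≃L[ℝ] V) {n dZ : ℕ} (e : Fin n ≃ κ)
  {θ : V [⋀^Fin 2]→L[ℝ] ℝ} (hnd : ∀ u : V, (∀ v, θ ![u, v] = 0) → u = 0)

/-- **Every cycle-type secant object sits on a POLARISED Weil-type triple.** `X = V/Ψ(ℤ^κ)` with a positively oriented `e`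
(`rk Λ = 2dZ + 2p`), `Z ⊂ X` closed analytic of pure dimension `dZ ≥ 1`, `[Z]_e = c • θ^{∧p}` with `c > 0`, `p ≥ 1`, `θ ∈ NS(X)`
non-degenerate of type `δ`, `d ∈ ℕ⁺`, `N = δ₀δ_g`: then `N·(-Ξ_d)` is a Riemann form of `X × X̂`, or `p` is even and `N·Ξ_d` is
(`Ξ_d = d·θ ⊞ θ^*`). [cite: Markman2025SecantWeil, §2.4 Prop. 2.4.4] [cite: Chirka1989, §14.2 Prop. 2] -/
theorem isRiemannForm_smul_neg_Xi_or_of_analyticCycleClass_eq_smul_wedgePow {p : ℕ} (h : 2 * dZ + 2 * p = n)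
    {Z : Set (ComplexTorus Ψ)} (hZ : HasPureDim 𝓘(ℂ, V) Z dZ) (he : orientationSign Ψ e = 1) (hp : 1 ≤ p) (hdZ : 1 ≤ dZ)
    (hθ : IsNSForm Ψ θ) {c : ℝ} (hc : 0 < c)
    (hcl : analyticCycleClass Ψ e h hZ = (c : ℂ) • wedgePow (ofRealForm θ) p)
    {g : ℕ} {δ : Fin (g + 1) → ℕ} (hδ : IsPolarizationType Ψ θ δ) {d : ℕ} (hd : 0 < d) :
    IsRiemannForm (prodPeriod Ψ (dualPeriod Ψ))
        (((δ 0 * δ (Fin.last g) : ℕ) : ℝ) • (-prodForm ((d : ℝ) • θ) (dualForm Ψ hθ.type_one_one hnd))) ∨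
      (Even p ∧ IsRiemannForm (prodPeriod Ψ (dualPeriod Ψ))
        (((δ 0 * δ (Fin.last g) : ℕ) : ℝ) • prodForm ((d : ℝ) • θ) (dualForm Ψ hθ.type_one_one hnd))) := by
  have hnd' : ∀ v : V, v ≠ 0 → ∃ w : V, θ ![v, w] ≠ 0 := fun v hv ↦ by
    by_contra h0
    push Not at h0
    exact hv (hnd v h0)
  rcases isRiemannForm_neg_or_of_analyticCycleClass_eq_smul_wedgePow Ψ e h hZ he hp hdZ hθ hnd' hc hcl with hneg | ⟨hev, hpos⟩
  · exact Or.inl ((isRiemannForm_smul_neg_Xi_iff Ψ hθ.type_one_one hnd hθ hδ hd).2 hneg)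
  · exact Or.inr ⟨hev, (isRiemannForm_smul_Xi_iff Ψ hθ.type_one_one hnd hθ hδ hd).2 hpos⟩

end CycleType

end SecantParity

end Summit.Ventures.HSemireg
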